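/-
Copyright (c) 2026. Released under Apache 2.0 license.
-/
import Summits.RiemannHypothesis.RiemannHypothesis.Theorems.MotivicDoorSemilocalUndecicCells
import Summits.RiemannHypothesis.RiemannHypothesis.Theorems.MotivicDoorSemilocalUndecicKernelB
import Summits.RiemannHypothesis.RiemannHypothesis.Theorems.MotivicDoorSemilocalMollifyPolar
import Summits.RiemannHypothesis.RiemannHypothesis.Theorems.MotivicDoorSemilocalQuinticBound
import HarnessLib

/-!
# Motivic door, semi-local ladder — rung R3⁻(0.57): `W_{∞,2}` fails on `C(a)` for every `a > 0.57`

Pub speedrun, cell `pub-rhdoor` ("motivic door"), ladder seat `lad-2`, generation 5.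

Honest framing (cell charter, verbatim): lottery ticket at the motivic door; RH probability
negligible; consolation prizes are real: a new semi-local Weil-positivity theorem, or a located
gap in the Connes–Consani programme, plus the ff-door theorem.  This file is on the
consolation-prize side and proves a NEGATIVE statement about the semi-local form; nothing here
bears on RH itself.

## The rung (PROVED here, sorry-free)

* `not_weilSemilocalPositivityOn_two_of_gt`: for every real `a > 57/100`, the archimedean-plus-
  `p = 2` Weil functional `W_{∞,2}` takes a negative value on some test function `g ⋆ g*` with
  `supp g ⊆ [-a, a]`; equivalently (`weilSemilocalThreshold_two_le`) the sharp threshold satisfies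
  `a*({2}) ≤ 0.57`, so that now `a*({2}) ∈ [563/1024, 57/100] = [0.5498, 0.57]`
  (generation 4 had `< 0.59`; DATA, not used: `a*({2}) = 0.5578…`).

## Proof

The polar-credit criterion `IsMarkovWitness.not_weilSemilocalPositivityOn_two_polar`
(`…MollifyPolar.lean`) applied to the odd degree-11 witness `G` of `…UndecicWitness.lean`
(`b = 0.57`): it suffices to certify
`(log 2/√2) D_{log 2}(G) + ∫₀^∞ w D(G) < C₂ ‖G‖² + 2 |Ĝ(1)|²`.
Term by term (`N = ‖G‖² ≈ 783495.24`): `D_{log 2}(G) = 2b Δ(log 2/b) ≤ 2b · BUD/2^48`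
(`…UndecicKernelB`); `∫₀^{2b} w D ≤ 211.21 + 2b² Σ_{i=1}^{2279} w(a_i) ∫_{τ_i}^{τ_{i+1}} Δ`, six
kernel blocks (`…UndecicKernelA/B`, cells `…UndecicCells`); `∫_{2b}^∞ w D ≤ 2N T(e^{-b})`;
`C₂ ≥ 4.0884869 + 2 K₂₀₀` (generation 4); `|Ĝ(1)| ≥ 125.97` (`…UndecicPolar`).  Certified totals:
`671631.44 + 211.21 + 2516553.78 + 1810897.57 = 4999293.99 < 4976119.00 + 31736.88 = 5007855.88`
(margin `0.0109 N`; true values `Re E₂(G)/N = -0.0164`, DATA, two engines, seat file `code/gen57.py`).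
All numerics by `decide +kernel` in the fixed-point interval engine; no `native_decide`.
-/

set_option linter.dupNamespace false

noncomputable section

open MeasureTheory Set Filter Topology Real Finset
open Literature.NumberTheory.LFunctions
open Literature.Analysis.ValidatedNumerics.Numerics

namespace Summit.RiemannHypothesis.RiemannHypothesis.Theorems.MotivicDoor.SemilocalUndecic

open SemilocalMarkov SemilocalKernel SemilocalUndecicKernel SemilocalQuintic SemilocalThreshold
  Semilocal

/-! ## The bulk `0 < t ≤ 2b` -/

/-- `∫_{(0,2b]} w D = Σ_{i<2280} ∫_{a_i}^{a_{i+1}} w D`. -/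
theorem integral_Ioc_eq_sumU :
    ∫ t in Ioc 0 (2 * bU), weilArchDensity t * weilIncrement GU t
      = ∑ i ∈ range 2280, ∫ t in ag i..ag (i + 1), weilArchDensity t * weilIncrement GU t := by
  rw [intervalIntegral.sum_integral_adjacent_intervals, ag_zero, ag_lastU,
    intervalIntegral.integral_of_le (by have := bU_pos; positivity)]
  intro k _
  have hk0 : 0 ≤ ag k := by unfold ag; positivity
  have hle : ag k ≤ ag (k + 1) := by unfold ag; push_cast; linarith
  exact (intervalIntegrable_iff_integrableOn_Ioc_of_le hle).2
    (integrableOn_w_mul_weilIncrement_GU.mono_set fun t ht ↦ lt_of_le_of_lt hk0 ht.1)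

/-- A block of `n` cells starting at `i₀ ≥ 1` is bounded by `2b² gchunkR iU 1140 i₀ n`. -/
theorem sum_cellsU_le {i0 n : ℕ} (h1 : 1 ≤ i0) (h2 : i0 + n ≤ 2280) :
    ∑ k ∈ range n, ∫ t in ag (i0 + k)..ag (i0 + k + 1), weilArchDensity t * weilIncrement GU t
      ≤ 2 * bU ^ 2 * gchunkR iU 1140 i0 n := by
  rw [gchunkR_eq_sum, Finset.mul_sum]
  exact Finset.sum_le_sum fun k hk ↦
    cellU_le (by omega) (by have := Finset.mem_range.1 hk; omega)

/-- The bulk: `∫_{(0,2b]} w D ≤ 211.21 + 2b² (BU1+BU2+BU3)/2^48 + 2b² (BU4+BU5+BU6)/2^48`. -/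
theorem bulk_integral_leU :
    ∫ t in Ioc 0 (2 * bU), weilArchDensity t * weilIncrement GU t
      ≤ 21121 / 100 + 2 * bU ^ 2 * (((BU1 + BU2 + BU3 : ℤ) : ℝ) / SC)
        + 2 * bU ^ 2 * (((BU4 + BU5 + BU6 : ℤ) : ℝ) / SC) := by
  rw [integral_Ioc_eq_sumU]
  set F : ℕ → ℝ := fun i ↦ ∫ t in ag i..ag (i + 1), weilArchDensity t * weilIncrement GU t
    with hF
  have s1 : ∑ i ∈ range 2280, F i = ∑ i ∈ range 1901, F i + ∑ k ∈ range 379, F (1901 + k) :=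
    Finset.sum_range_add F 1901 379
  have s2 : ∑ i ∈ range 1901, F i = ∑ i ∈ range 1521, F i + ∑ k ∈ range 380, F (1521 + k) :=
    Finset.sum_range_add F 1521 380
  have s3 : ∑ i ∈ range 1521, F i = ∑ i ∈ range 1141, F i + ∑ k ∈ range 380, F (1141 + k) :=
    Finset.sum_range_add F 1141 380
  have s4 : ∑ i ∈ range 1141, F i = ∑ i ∈ range 761, F i + ∑ k ∈ range 380, F (761 + k) :=
    Finset.sum_range_add F 761 380
  have s5 : ∑ i ∈ range 761, F i = ∑ i ∈ range 381, F i + ∑ k ∈ range 380, F (381 + k) :=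
    Finset.sum_range_add F 381 380
  have s6 : ∑ i ∈ range 381, F i = ∑ i ∈ range 1, F i + ∑ k ∈ range 380, F (1 + k) :=
    Finset.sum_range_add F 1 380
  rw [s1, s2, s3, s4, s5, s6, Finset.sum_range_one]
  have h0 : F 0 ≤ 21121 / 100 := cellU_zero_le
  have hc1 : ∑ k ∈ range 380, F (1 + k) ≤ 2 * bU ^ 2 * gchunkR iU 1140 1 380 :=
    sum_cellsU_le le_rfl (by norm_num)
  have hc2 : ∑ k ∈ range 380, F (381 + k) ≤ 2 * bU ^ 2 * gchunkR iU 1140 381 380 :=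
    sum_cellsU_le (by norm_num) (by norm_num)
  have hc3 : ∑ k ∈ range 380, F (761 + k) ≤ 2 * bU ^ 2 * gchunkR iU 1140 761 380 :=
    sum_cellsU_le (by norm_num) (by norm_num)
  have hc4 : ∑ k ∈ range 380, F (1141 + k) ≤ 2 * bU ^ 2 * gchunkR iU 1140 1141 380 :=
    sum_cellsU_le (by norm_num) (by norm_num)
  have hc5 : ∑ k ∈ range 380, F (1521 + k) ≤ 2 * bU ^ 2 * gchunkR iU 1140 1521 380 :=
    sum_cellsU_le (by norm_num) (by norm_num)
  have hc6 : ∑ k ∈ range 379, F (1901 + k) ≤ 2 * bU ^ 2 * gchunkR iU 1140 1901 379 :=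
    sum_cellsU_le (by norm_num) (by norm_num)
  have hb2 : (0 : ℝ) ≤ 2 * bU ^ 2 := mul_nonneg zero_le_two (sq_nonneg bU)
  have hA := mul_le_mul_of_nonneg_left bulkA_le hb2
  have hB := mul_le_mul_of_nonneg_left bulkB_le hb2
  -- (no `linarith` here: its preprocessing would expand the 2280-term sums in context)
  calc F 0 + ∑ k ∈ range 380, F (1 + k) + ∑ k ∈ range 380, F (381 + k)
        + ∑ k ∈ range 380, F (761 + k) + ∑ k ∈ range 380, F (1141 + k)
        + ∑ k ∈ range 380, F (1521 + k) + ∑ k ∈ range 379, F (1901 + k)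
      ≤ 21121 / 100 + 2 * bU ^ 2 * gchunkR iU 1140 1 380 + 2 * bU ^ 2 * gchunkR iU 1140 381 380
        + 2 * bU ^ 2 * gchunkR iU 1140 761 380 + 2 * bU ^ 2 * gchunkR iU 1140 1141 380
        + 2 * bU ^ 2 * gchunkR iU 1140 1521 380 + 2 * bU ^ 2 * gchunkR iU 1140 1901 379 :=
        add_le_add (add_le_add (add_le_add (add_le_add (add_le_add (add_le_add h0 hc1) hc2) hc3)
          hc4) hc5) hc6
    _ = 21121 / 100 + 2 * bU ^ 2 * (gchunkR iU 1140 1 380 + gchunkR iU 1140 381 380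
          + gchunkR iU 1140 761 380)
        + 2 * bU ^ 2 * (gchunkR iU 1140 1141 380 + gchunkR iU 1140 1521 380
          + gchunkR iU 1140 1901 379) := by ring
    _ ≤ _ := add_le_add (add_le_add le_rfl hA) hB

/-! ## The certified inequality -/

/-- **The certified Markov inequality for the degree-11 witness, with polar credit**:
`(log 2/√2) D_{log 2}(G) + ∫₀^∞ w D(G) < C₂ ‖G‖² + 2 |Ĝ(1)|²`. -/
theorem arch_lt_polarU :
    Real.log 2 / Real.sqrt 2 * weilIncrement GU (Real.log 2)
      + (∫ t in Ioi (0 : ℝ), weilArchDensity t * weilIncrement GU t)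
      < semilocalTwoConstant * (∫ x, ‖GU x‖ ^ 2) + 2 * ‖weilMellin GU 1‖ ^ 2 := by
  have hb := bU_pos
  have hl1 := Real.log_two_gt_d9
  have hl2 := Real.log_two_lt_d9
  have hSC := SC_pos
  -- D(log 2)
  have hD : weilIncrement GU (Real.log 2) ≤ 2 * bU * ((BUD : ℝ) / SC) := by
    rw [weilIncrement_GU_eq (by linarith) (by unfold bU; linarith)]
    refine mul_le_mul_of_nonneg_left ?_ (by positivity)
    have h := hornerR_dU_log_two_le
    rw [hornerR_eq_polyR] at h
    exact h
  have h1 : Real.log 2 / Real.sqrt 2 * weilIncrement GU (Real.log 2)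
      ≤ 4901291 / 10000000 * (2 * bU * ((BUD : ℝ) / SC)) :=
    mul_le_mul log_two_div_sqrt_two_le hD (weilIncrement_nonneg _ _) (by norm_num)
  -- split the integral
  have hfin := integrableOn_w_mul_weilIncrement_GU
  have hI : ∫ t in Ioi (0 : ℝ), weilArchDensity t * weilIncrement GU t
      = (∫ t in Ioc 0 (2 * bU), weilArchDensity t * weilIncrement GU t)
        + ∫ t in Ioi (2 * bU), weilArchDensity t * weilIncrement GU t := by
    rw [← setIntegral_union Ioc_disjoint_Ioi_same measurableSet_Ioi
      (hfin.mono_set Ioc_subset_Ioi_self) (hfin.mono_set (Ioi_subset_Ioi (by positivity))),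
      Ioc_union_Ioi_eq_Ioi (by positivity)]
  have h2 := bulk_integral_leU
  have hN2 : 0 ≤ 2 * NU := by unfold NU n2U bU; norm_num
  have hT : tailT (Real.exp (-bU)) ≤ (BUT : ℝ) / SC := by unfold bU; exact tailTU_le
  have h3 : ∫ t in Ioi (2 * bU), weilArchDensity t * weilIncrement GU t ≤ 2 * NU * ((BUT : ℝ) / SC) :=
    tailU_le.trans (mul_le_mul_of_nonneg_left hT hN2)
  -- the constant
  have hC := const_le_semilocalTwoConstant
  have hK := kLo_le_kSum
  have hNU : 0 ≤ NU := NU_nonneg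
  have h4 : (40884869 / 10000000 + 2 * ((KL : ℝ) / SC)) * NU ≤ semilocalTwoConstant * NU :=
    mul_le_mul_of_nonneg_right (by linarith) hNU
  -- the polar credit
  have hP : 2 * (12597 / 100 : ℝ) ^ 2 ≤ 2 * ‖weilMellin GU 1‖ ^ 2 := by
    have h := polar_moment_le_norm
    have h0 : (0 : ℝ) ≤ 12597 / 100 := by norm_num
    nlinarith [h, h0]
  have key : 4901291 / 10000000 * (2 * bU * ((BUD : ℝ) / SC))
      + ((21121 / 100 + 2 * bU ^ 2 * (((BU1 + BU2 + BU3 : ℤ) : ℝ) / SC)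
          + 2 * bU ^ 2 * (((BU4 + BU5 + BU6 : ℤ) : ℝ) / SC)) + 2 * NU * ((BUT : ℝ) / SC))
      < (40884869 / 10000000 + 2 * ((KL : ℝ) / SC)) * NU + 2 * (12597 / 100 : ℝ) ^ 2 := by
    simp only [bU, NU, n2U, BU1, BU2, BU3, BU4, BU5, BU6, BUD, BUT, KL, SC]
    push_cast
    norm_num
  rw [integral_norm_sq_GU, hI]
  linarith

/-! ## The rung -/

/-- `W_{∞,2}` fails on `C(B)` for `0.57 < B ≤ log 2`. -/
theorem not_weilSemilocalPositivityOn_two_of_gt_of_le {B : ℝ} (hbB : bU < B)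
    (hB : B ≤ Real.log 2) : ¬ WeilSemilocalPositivityOn ({2} : Finset ℕ) B :=
  isMarkovWitness_GU.not_weilSemilocalPositivityOn_two_polar integrableOn_w_mul_weilIncrement_GU
    arch_lt_polarU hbB hB

/-- **Rung R3⁻(0.57).**  For every `a > 0.57` the semi-local Weil form at `S = {∞, 2}` takes a
negative value on some test function supported in `[-a, a]`:
`¬ WeilSemilocalPositivityOn {2} a`.  (Below `log 2`: the degree-11 Markov certificate with polar
credit; at and above `log 2`: generation 2's Jensen-window witness.) -/
theorem not_weilSemilocalPositivityOn_two_of_gt {a : ℝ} (ha : (57 / 100 : ℝ) < a) :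
    ¬ WeilSemilocalPositivityOn ({2} : Finset ℕ) a := by
  by_cases h : a ≤ Real.log 2
  · exact not_weilSemilocalPositivityOn_two_of_gt_of_le ha h
  · exact not_weilSemilocalPositivityOn_two_of_log_two_le (le_of_not_ge h)

/-- The same for every finite set of places `S ∋ 2`, `3 ∉ S` (the `{∞,2}` form is the semi-local
form of every such `S` on `C(a)`, `a ≤ (log 5)/2`). -/
theorem not_weilSemilocalPositivityOn_of_gt {S : Finset ℕ} (h2 : 2 ∈ S) (h3 : 3 ∉ S) {a : ℝ}
    (ha : (57 / 100 : ℝ) < a) : ¬ WeilSemilocalPositivityOn S a := by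
  by_cases h : a ≤ Real.log 2
  · rw [weilSemilocalPositivityOn_iff_two h2 h3 (h.trans log_two_le_log_five_half)]
    exact not_weilSemilocalPositivityOn_two_of_gt ha
  · exact not_weilSemilocalPositivityOn_of_log_two_le h2 h3 (le_of_not_ge h)

/-- **The threshold form of the rung**: `a*({2}) ≤ 0.57`. -/
theorem weilSemilocalThreshold_two_le : weilSemilocalThreshold {2} ≤ 57 / 100 := by
  by_contra h
  obtain ⟨a, ha1, ha2⟩ := exists_between (lt_of_not_ge h)
  exact not_weilSemilocalPositivityOn_two_of_gt ha1
    (weilSemilocalPositivityOn_iff_le_weilSemilocalThreshold.2 ha2.le)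

/-- **Rung R3 as one number, generation 5**: `a*({2}) ∈ [563/1024, 57/100]`. -/
theorem weilSemilocalThreshold_two_mem_Icc :
    weilSemilocalThreshold {2} ∈ Icc (((weilCert3C.b : ℚ) : ℝ)) (57 / 100) :=
  ⟨weilSemilocalThreshold_two_mem_Ico.1, weilSemilocalThreshold_two_le⟩

/-- Decimal form: `0.5498 ≤ a*({2}) ≤ 0.57` (PROVED; DATA, not used: `a*({2}) = 0.5578…`). -/
theorem weilSemilocalThreshold_two_bounds'' :
    (0.5498 : ℝ) ≤ weilSemilocalThreshold {2} ∧ weilSemilocalThreshold {2} ≤ 0.57 :=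
  ⟨weilSemilocalThreshold_two_bounds.1,
    by have := weilSemilocalThreshold_two_le; norm_num at this ⊢; exact this⟩

/-- For every finite `S` with `2 ∈ S ∌ 3`: `a*(S) ≤ 0.57`. -/
theorem weilSemilocalThreshold_le_of_two_three {S : Finset ℕ} (h2 : 2 ∈ S) (h3 : 3 ∉ S) :
    weilSemilocalThreshold S ≤ 57 / 100 := by
  rw [weilSemilocalThreshold_eq_two h2 h3]; exact weilSemilocalThreshold_two_le

end Summit.RiemannHypothesis.RiemannHypothesis.Theorems.MotivicDoor.SemilocalUndecic

end
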